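/-
Copyright (c) 2026 the pub-hodgecm-mathlib formalisation cell (harness21).  Prover seat hodgecm-mathlib-LA3-p01 (g0), P6 «MOD programme», half A line L3 (ROOF road),
organ **(ν8R)** «kernel readings of a reduced homomorphism along the valuation-ring model», abstract part (LA3-plan (R1) 2026-09-02 03:30:21Z, 04:00:01Z «(c) =»); 2026-09-02.
-/
import Literature.AlgebraicGeometry.AbelianSchemes.AbelianSchemeHomReductionSpecialFibre
import Literature.AlgebraicGeometry.AbelianSchemes.AbelianSchemeFibreAlongStageCoherence
import Literature.AlgebraicGeometry.AbelianSchemes.KernelClauseSpecialOfGeneric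
import Literature.AlgebraicGeometry.GroupSchemes.GroupSchemeKernelBaseChange
import HarnessLib

/-!
# KERNEL READINGS OF A REDUCED HOMOMORPHISM ALONG A FLAT SUBGROUP OF THE VALUATION-RING MODEL
# (the abstract two-stage setting of ★ (ν8) §1 with a model base `x_R = (r ≫ g) ≫ z`; [SerreTate1968] §1 Lemma 2, [BoschLutkebohmertRaynaud1990] §7.1)

Topic `AlgebraicGeometry/AbelianSchemes`, namespace `Literature.AlgebraicGeometry.AbelianSchemes.AbelianSchemeOver`.  THEOREMS ONLY (no definition, no named fact, no
instance, no notation).  Cell `hodgecm-mathlib` (D-0151), F0∕P6 «MOD», organ **(ν8R)**, abstract part.  SETTING: the two-stage setting of ★ (ν8) §1 — `𝒜, 𝒞 → T`, a stage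
`V′ → V → T` (`g`; `z`, `z″`), a stage homomorphism `U : (𝒜_z)_{V′} → (𝒞_{z″})_{V′}` whose fibre at the schematically dominant point `a′` is `u : (𝒜|_U)_y → (𝒞|_U)_{y″}` through
the five-piece isomorphisms (`hfib`), special data `js, ys, ys″, b, b′`, and the reduced homomorphism `ū := E_𝒜 ≫ U_{b′} ≫ E_𝒞⁻¹` — PLUS a finer base `r : V_r → V′` (the valuation
ring `R` of the point under the finite Dedekind stage) with points `η_r`, `s_r` over `a′`, `b′` (`η_r` quasi-compact schematically dominant) and the `R`-MODEL `𝒜_{x_R}`,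
`x_R = (r ≫ g) ≫ z` (a BINDER `x_R` with `hxR`, so that consumers instantiate `x_R :=` ★ `extendPoint …` literally).  A sub-object `incl : 𝒦 → 𝒜_{x_R}` with `𝒦 → V_r` FLAT
is read upstairs in `(𝒜|_U)_y` and downstairs in `(𝒜|_{U_s})_{ys}` through the THREE-PIECE isomorphisms of ★ (d5) `AbelianSchemeFibreAlongIntegralPoint`
(`fibreBaseChangeIso ≪≫ fibreCongrPtIso ≪≫ fibreBaseChangeIso⁻¹`, written explicitly).
§2 `pullback_map_comp_specialFibre_eq_one_of_generic` (KILL: `𝒦_{η_r}` killed by `u` ⇒ `𝒦_{s_r}` killed by `ū`; flat `𝒦` only),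
`kernelClause_specialFibre_of_generic_model` (CLAUSE: `𝒦_{η_r}` = `Ker u` on `T`-points ⇒ `𝒦_{s_r}` = `Ker ū` on `T`-points; `incl` a closed immersion, `Ker U` flat), and
`specialFibre_transfers_of_generic_model` (the six transfers (i)–(iv), (v-b), (v-a) in ONE application, for the head).  ROAD: transport `U_{V_r}` to the `R`-model along the
transitivity isomorphisms (★ `baseChangeCompGrpIso`), identify its fibres at `η_r`∕`s_r` with `u`∕`ū` through the three-piece isomorphisms (★ (ν8R-coh)
`fibreHom_comp_five_inv_eq_three_inv`), and apply ★ (v-gen) `KernelClauseSpecialOfGeneric` (KILL ∕ KILL + LIFT) over `V_r`.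
Consumer: the head ★ `AbelianSchemeHomReductionSpecialFibreModel` ((ν8) + (v-b) + (v-a) at `R := 𝒪_Ω̄`, `x_R :=` ★ `extendPoint`), then L2's `spGeoOf` kernel reading and
L3's `stub_ROOFGEO`.

HONEST LABEL: HC_CM is proved only modulo the cell's 2 remaining named inputs (hLiu418 24832, h413 24833) until rung 0 closes; generic capital on
`--supports stmt-HodgeConjecture-24832`, pays no letter.

## References
* [SerreTate1968] J.-P. Serre, J. Tate, *Good reduction of abelian varieties*, Ann. of Math. 88 (1968), §1 Lemma 2, Theorem 1.
* [BoschLutkebohmertRaynaud1990] S. Bosch, W. Lütkebohmert, M. Raynaud, *Néron Models* (1990), §7.1 Lemma 5 ∕ Prop. 6 (pp. 176–180), §7.3 Prop. 6.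
* [GortzWedhorn2020] U. Görtz, T. Wedhorn, *Algebraic Geometry I*, 2nd ed. (2020), Section (4.7) (p. 135), Definition 4.45 (2) (p. 117).
* [MumfordFogartyKirwan1994] D. Mumford, J. Fogarty, F. Kirwan, *GIT*, 3rd ed., Ch. 6 §1 Cor. 6.2 (p. 116), Ch. 7 §2 Def. 7.2 (p. 129).
* [EGAIV3] A. Grothendieck, J. Dieudonné, EGA IV₃ (1966), 11.10.5.
-/

set_option autoImplicit false

noncomputable section

set_option backward.isDefEq.respectTransparency false

universe u

open CategoryTheory CategoryTheory.Limits AlgebraicGeometry MonoidalCategory CartesianMonoidalCategory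
open scoped MonObj CategoryTheory.Obj
open Literature.AlgebraicGeometry.Motives
open Literature.AlgebraicGeometry.GroupSchemes.GroupSchemeKernel (ker kerι kerLift kerLift_ι kerι_comp)
open Literature.AlgebraicGeometry.Limits (pullback_map_injective_of_flat)

namespace Literature.AlgebraicGeometry.AbelianSchemes

namespace AbelianSchemeOver

section Model

/-! ### §2 Kernel readings transfer along a flat `𝒦 ↪ 𝒜_{x_R}` (two-stage setting of ★ (ν8) §1 + model base `x_R = (r ≫ g) ≫ z`) -/

/-- Post-composition with an isomorphism of abelian varieties detects the unit. [folklore] -/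
private theorem comp_avIso_hom_eq_one_iff' {k : Type u} [Field k] {X Y : AbelianVariety k} (E : X ≅ Y) {W : Over (Spec (.of k))} (f : W ⟶ X.X) :
    f ≫ E.hom.hom.hom.hom = 1 ↔ f = 1 := by
  refine ⟨fun h => ?_, fun h => by rw [h, MonObj.one_comp]⟩
  have h1 := congrArg (fun φ => φ ≫ E.inv.hom.hom.hom) h
  simp only [Category.assoc, AbelianVariety.iso_hom_hom_hom_hom_comp_inv, Category.comp_id, MonObj.one_comp] at h1
  exact h1

variable {T Ug V V' Us Vr : Scheme.{u}} {Ω κ : Type u} [Field Ω] [Field κ]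
  (j : Ug ⟶ T) (z z'' : V ⟶ T) (g : V' ⟶ V) (y y'' : Spec (.of Ω) ⟶ Ug) (a : Spec (.of Ω) ⟶ V) (a' : Spec (.of Ω) ⟶ V')
  (hpt : y ≫ j = a ≫ z) (hpt'' : y'' ≫ j = a ≫ z'') (e : a' ≫ g = a)
  (js : Us ⟶ T) (ys ys'' : Spec (.of κ) ⟶ Us) (b : Spec (.of κ) ⟶ V) (b' : Spec (.of κ) ⟶ V')
  (hspt : ys ≫ js = b ≫ z) (hspt'' : ys'' ≫ js = b ≫ z'') (es : b' ≫ g = b)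
  (𝒜 𝒞 : AbelianSchemeOver T)
  (U : ((𝒜.baseChange z).baseChange g).X ⟶ ((𝒞.baseChange z'').baseChange g).X) [IsMonHom U]
  (u : ((𝒜.baseChange j).baseChange y).X ⟶ ((𝒞.baseChange j).baseChange y'').X) [IsMonHom u]
  (hfib : fibreHom U a' =
    (𝒜.fibreBaseChangeIso j y ≪≫ 𝒜.fibreCongrPtIso hpt ≪≫ (𝒜.fibreBaseChangeIso z a).symm ≪≫ ((𝒜.baseChange z).fibreCongrPtIso e).symm ≪≫ ((𝒜.baseChange z).fibreBaseChangeIso g a').symm).inv ≫ homOfIsMonHom u ≫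
      (𝒞.fibreBaseChangeIso j y'' ≪≫ 𝒞.fibreCongrPtIso hpt'' ≪≫ (𝒞.fibreBaseChangeIso z'' a).symm ≪≫ ((𝒞.baseChange z'').fibreCongrPtIso e).symm ≪≫ ((𝒞.baseChange z'').fibreBaseChangeIso g a').symm).hom)
  (r : Vr ⟶ V') (xR : Vr ⟶ T) (hxR : xR = (r ≫ g) ≫ z) (ηr : Spec (.of Ω) ⟶ Vr) (sr : Spec (.of κ) ⟶ Vr)
  (hηr : ηr ≫ r = a') (hsr : sr ≫ r = b') [QuasiCompact ηr] [IsSchemeTheoreticallyDominant ηr]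
  (hpr : y ≫ j = ηr ≫ xR) (hps : ys ≫ js = sr ≫ xR)

include hfib hxR hηr hsr in
set_option maxHeartbeats 400000 in
/-- **KILLING TRANSFERS ALONG A FLAT `𝒦 ↪ 𝒜_{x_R}`.**  In the abstract two-stage setting of ★ (ν8) §1, let the base `x_R : V_r → T` of an `R`-MODEL factor through the
stage, `x_R = (r ≫ g) ≫ z`, with points `η_r`, `s_r` of `V_r` over `a′`, `b′` (`η_r` quasi-compact schematically dominant — the generic point of a valuation ring), and let
`incl : 𝒦 → 𝒜_{x_R}` with `𝒦 → V_r` FLAT.  If `𝒦_{η_r}`, read in `(𝒜|_U)_y` through the three-piece isomorphism `(𝒜|_U)_y ≅ 𝒜_{y ≫ j} = 𝒜_{η_r ≫ x_R} ≅ (𝒜_{x_R})_{η_r}`, is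
killed by `u`, then `𝒦_{s_r}`, read in `(𝒜|_{U_s})_{ys}` through the special three-piece isomorphism, is killed by `ū := E_𝒜 ≫ U_{b′} ≫ E_𝒞⁻¹` (§1 coherence + ★ (v-gen) KILL
`comp_eq_one_of_pullback_map_comp_eq_one` over `V_r`). [cite: BoschLutkebohmertRaynaud1990, §7.1 Lemma 5 (p. 176)] [cite: SerreTate1968, §1 Lemma 2] [cite: EGAIV3, 11.10.5] -/
theorem pullback_map_comp_specialFibre_eq_one_of_generic (𝒦 : Over Vr) (incl : 𝒦 ⟶ (𝒜.baseChange xR).X) [Flat 𝒦.hom]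
    (hkill : ((Over.pullback ηr).map incl ≫ (𝒜.fibreBaseChangeIso j y ≪≫ 𝒜.fibreCongrPtIso hpr ≪≫ (𝒜.fibreBaseChangeIso xR ηr).symm).inv.hom.hom.hom) ≫ u = 1) :
    ((Over.pullback sr).map incl ≫ (𝒜.fibreBaseChangeIso js ys ≪≫ 𝒜.fibreCongrPtIso hps ≪≫ (𝒜.fibreBaseChangeIso xR sr).symm).inv.hom.hom.hom) ≫
      ((𝒜.fibreBaseChangeIso js ys ≪≫ 𝒜.fibreCongrPtIso hspt ≪≫ (𝒜.fibreBaseChangeIso z b).symm ≪≫ ((𝒜.baseChange z).fibreCongrPtIso es).symm ≪≫ ((𝒜.baseChange z).fibreBaseChangeIso g b').symm).hom ≫ fibreHom U b' ≫ (𝒞.fibreBaseChangeIso js ys'' ≪≫ 𝒞.fibreCongrPtIso hspt'' ≪≫ (𝒞.fibreBaseChangeIso z'' b).symm ≪≫ ((𝒞.baseChange z'').fibreCongrPtIso es).symm ≪≫ ((𝒞.baseChange z'').fibreBaseChangeIso g b').symm).inv).hom.hom.hom = 1 := by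
  subst hxR hηr hsr
  haveI := isMonHom_baseChangeHom U r
  -- the generic fibre of `τ ≫ U_r` (`τ` the transitivity isomorphisms), through §1 coherence and `hfib`
  have hbc : fibreHom (baseChangeHom U r) ηr = (((𝒜.baseChange z).baseChange g).fibreBaseChangeIso r ηr).hom ≫ fibreHom U (ηr ≫ r) ≫ (((𝒞.baseChange z'').baseChange g).fibreBaseChangeIso r ηr).inv := by
    rw [← Category.assoc, Iso.eq_comp_inv]
    exact fibreHom_baseChangeHom_comp_fibreBaseChangeIso_hom r ηr U
  have hAV : fibreHom (((𝒜.baseChangeCompGrpIso z (r ≫ g)).hom.hom.hom ≫ ((𝒜.baseChange z).baseChangeCompGrpIso g r).hom.hom.hom) ≫ baseChangeHom U r) ηr =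
      (𝒜.fibreBaseChangeIso j y ≪≫ 𝒜.fibreCongrPtIso hpr ≪≫ (𝒜.fibreBaseChangeIso ((r ≫ g) ≫ z) ηr).symm).inv ≫ homOfIsMonHom u ≫
        (𝒞.fibreBaseChangeIso j y'' ≪≫ 𝒞.fibreCongrPtIso hpt'' ≪≫ (𝒞.fibreBaseChangeIso z'' a).symm ≪≫ ((𝒞.baseChange z'').fibreCongrPtIso e).symm ≪≫ ((𝒞.baseChange z'').fibreBaseChangeIso g (ηr ≫ r)).symm).hom ≫ (((𝒞.baseChange z'').baseChange g).fibreBaseChangeIso r ηr).inv := by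
    rw [fibreHom_comp, hbc, hfib, ← fibreHom_comp_five_inv_eq_three_inv j z g r y a ηr hpt e hpr 𝒜]
    simp only [Category.assoc]
  -- KILL over `V_r`
  have hK : incl ≫ (((𝒜.baseChangeCompGrpIso z (r ≫ g)).hom.hom.hom ≫ ((𝒜.baseChange z).baseChangeCompGrpIso g r).hom.hom.hom) ≫ baseChangeHom U r) = 1 := by
    apply comp_eq_one_of_pullback_map_comp_eq_one ηr (((𝒜.baseChangeCompGrpIso z (r ≫ g)).hom.hom.hom ≫ ((𝒜.baseChange z).baseChangeCompGrpIso g r).hom.hom.hom) ≫ baseChangeHom U r) incl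
    have e1 : (Over.pullback ηr).map (((𝒜.baseChangeCompGrpIso z (r ≫ g)).hom.hom.hom ≫ ((𝒜.baseChange z).baseChangeCompGrpIso g r).hom.hom.hom) ≫ baseChangeHom U r) =
        (𝒜.fibreBaseChangeIso j y ≪≫ 𝒜.fibreCongrPtIso hpr ≪≫ (𝒜.fibreBaseChangeIso ((r ≫ g) ≫ z) ηr).symm).inv.hom.hom.hom ≫ u ≫
          ((𝒞.fibreBaseChangeIso j y'' ≪≫ 𝒞.fibreCongrPtIso hpt'' ≪≫ (𝒞.fibreBaseChangeIso z'' a).symm ≪≫ ((𝒞.baseChange z'').fibreCongrPtIso e).symm ≪≫ ((𝒞.baseChange z'').fibreBaseChangeIso g (ηr ≫ r)).symm).hom ≫ (((𝒞.baseChange z'').baseChange g).fibreBaseChangeIso r ηr).inv).hom.hom.hom := by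
      change (fibreHom (((𝒜.baseChangeCompGrpIso z (r ≫ g)).hom.hom.hom ≫ ((𝒜.baseChange z).baseChangeCompGrpIso g r).hom.hom.hom) ≫ baseChangeHom U r) ηr).hom.hom.hom = _
      rw [hAV]
      rfl
    rw [e1, ← Category.assoc, ← Category.assoc, hkill, MonObj.one_comp]
  -- the special fibre of `τ ≫ U_r`
  have hbcs : fibreHom (baseChangeHom U r) sr = (((𝒜.baseChange z).baseChange g).fibreBaseChangeIso r sr).hom ≫ fibreHom U (sr ≫ r) ≫ (((𝒞.baseChange z'').baseChange g).fibreBaseChangeIso r sr).inv := by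
    rw [← Category.assoc, Iso.eq_comp_inv]
    exact fibreHom_baseChangeHom_comp_fibreBaseChangeIso_hom r sr U
  have hAVs : fibreHom (((𝒜.baseChangeCompGrpIso z (r ≫ g)).hom.hom.hom ≫ ((𝒜.baseChange z).baseChangeCompGrpIso g r).hom.hom.hom) ≫ baseChangeHom U r) sr =
      (𝒜.fibreBaseChangeIso js ys ≪≫ 𝒜.fibreCongrPtIso hps ≪≫ (𝒜.fibreBaseChangeIso ((r ≫ g) ≫ z) sr).symm).inv ≫
        ((𝒜.fibreBaseChangeIso js ys ≪≫ 𝒜.fibreCongrPtIso hspt ≪≫ (𝒜.fibreBaseChangeIso z b).symm ≪≫ ((𝒜.baseChange z).fibreCongrPtIso es).symm ≪≫ ((𝒜.baseChange z).fibreBaseChangeIso g (sr ≫ r)).symm).hom ≫ fibreHom U (sr ≫ r) ≫ (𝒞.fibreBaseChangeIso js ys'' ≪≫ 𝒞.fibreCongrPtIso hspt'' ≪≫ (𝒞.fibreBaseChangeIso z'' b).symm ≪≫ ((𝒞.baseChange z'').fibreCongrPtIso es).symm ≪≫ ((𝒞.baseChange z'').fibreBaseChangeIso g (sr ≫ r)).symm).inv)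 ≫
        (𝒞.fibreBaseChangeIso js ys'' ≪≫ 𝒞.fibreCongrPtIso hspt'' ≪≫ (𝒞.fibreBaseChangeIso z'' b).symm ≪≫ ((𝒞.baseChange z'').fibreCongrPtIso es).symm ≪≫ ((𝒞.baseChange z'').fibreBaseChangeIso g (sr ≫ r)).symm).hom ≫ (((𝒞.baseChange z'').baseChange g).fibreBaseChangeIso r sr).inv := by
    rw [fibreHom_comp, hbcs, ← fibreHom_comp_five_inv_eq_three_inv js z g r ys b sr hspt es hps 𝒜]
    simp only [Category.assoc, Iso.inv_hom_id_assoc]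
  have hS : (Over.pullback sr).map incl ≫ (Over.pullback sr).map (((𝒜.baseChangeCompGrpIso z (r ≫ g)).hom.hom.hom ≫ ((𝒜.baseChange z).baseChangeCompGrpIso g r).hom.hom.hom) ≫ baseChangeHom U r) =
      (1 : _ ⟶ ((((𝒞.baseChange z'').baseChange g).baseChange r).baseChange sr).X) := by
    rw [← Functor.map_comp, hK, pullback_map_one]
  have e2 : (Over.pullback sr).map (((𝒜.baseChangeCompGrpIso z (r ≫ g)).hom.hom.hom ≫ ((𝒜.baseChange z).baseChangeCompGrpIso g r).hom.hom.hom) ≫ baseChangeHom U r) =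
      (𝒜.fibreBaseChangeIso js ys ≪≫ 𝒜.fibreCongrPtIso hps ≪≫ (𝒜.fibreBaseChangeIso ((r ≫ g) ≫ z) sr).symm).inv.hom.hom.hom ≫
        ((𝒜.fibreBaseChangeIso js ys ≪≫ 𝒜.fibreCongrPtIso hspt ≪≫ (𝒜.fibreBaseChangeIso z b).symm ≪≫ ((𝒜.baseChange z).fibreCongrPtIso es).symm ≪≫ ((𝒜.baseChange z).fibreBaseChangeIso g (sr ≫ r)).symm).hom ≫ fibreHom U (sr ≫ r) ≫ (𝒞.fibreBaseChangeIso js ys'' ≪≫ 𝒞.fibreCongrPtIso hspt'' ≪≫ (𝒞.fibreBaseChangeIso z'' b).symm ≪≫ ((𝒞.baseChange z'').fibreCongrPtIso es).symm ≪≫ ((𝒞.baseChange z'').fibreBaseChangeIso g (sr ≫ r)).symm).inv).hom.hom.hom ≫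
        ((𝒞.fibreBaseChangeIso js ys'' ≪≫ 𝒞.fibreCongrPtIso hspt'' ≪≫ (𝒞.fibreBaseChangeIso z'' b).symm ≪≫ ((𝒞.baseChange z'').fibreCongrPtIso es).symm ≪≫ ((𝒞.baseChange z'').fibreBaseChangeIso g (sr ≫ r)).symm) ≪≫ (((𝒞.baseChange z'').baseChange g).fibreBaseChangeIso r sr).symm).hom.hom.hom.hom := by
    change (fibreHom (((𝒜.baseChangeCompGrpIso z (r ≫ g)).hom.hom.hom ≫ ((𝒜.baseChange z).baseChangeCompGrpIso g r).hom.hom.hom) ≫ baseChangeHom U r) sr).hom.hom.hom = _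
    rw [hAVs]
    rfl
  rw [e2] at hS
  have hS' : (((Over.pullback sr).map incl ≫ (𝒜.fibreBaseChangeIso js ys ≪≫ 𝒜.fibreCongrPtIso hps ≪≫ (𝒜.fibreBaseChangeIso ((r ≫ g) ≫ z) sr).symm).inv.hom.hom.hom) ≫
      ((𝒜.fibreBaseChangeIso js ys ≪≫ 𝒜.fibreCongrPtIso hspt ≪≫ (𝒜.fibreBaseChangeIso z b).symm ≪≫ ((𝒜.baseChange z).fibreCongrPtIso es).symm ≪≫ ((𝒜.baseChange z).fibreBaseChangeIso g (sr ≫ r)).symm).hom ≫ fibreHom U (sr ≫ r) ≫ (𝒞.fibreBaseChangeIso js ys'' ≪≫ 𝒞.fibreCongrPtIso hspt'' ≪≫ (𝒞.fibreBaseChangeIso z'' b).symm ≪≫ ((𝒞.baseChange z'').fibreCongrPtIso es).symm ≪≫ ((𝒞.baseChange z'').fibreBaseChangeIso g (sr ≫ r)).symm).inv).hom.hom.hom) ≫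
      ((𝒞.fibreBaseChangeIso js ys'' ≪≫ 𝒞.fibreCongrPtIso hspt'' ≪≫ (𝒞.fibreBaseChangeIso z'' b).symm ≪≫ ((𝒞.baseChange z'').fibreCongrPtIso es).symm ≪≫ ((𝒞.baseChange z'').fibreBaseChangeIso g (sr ≫ r)).symm) ≪≫ (((𝒞.baseChange z'').baseChange g).fibreBaseChangeIso r sr).symm).hom.hom.hom.hom = 1 := by
    simpa only [Category.assoc] using hS
  exact (comp_avIso_hom_eq_one_iff' _ _).1 hS'

/-- `e.hom ≫ e.inv = 𝟙` on the underlying objects, for an isomorphism of group objects. [folklore] -/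
private theorem grpIso_hom_hom_comp_inv {C : Type*} [Category C] [CartesianMonoidalCategory C] {G H : Grp C} (e : G ≅ H) :
    e.hom.hom.hom ≫ e.inv.hom.hom = 𝟙 G.X := by
  change (e.hom ≫ e.inv).hom.hom = _
  rw [Iso.hom_inv_id]
  rfl

/-- `e.inv ≫ e.hom = 𝟙` on the underlying objects, for an isomorphism of group objects. [folklore] -/
private theorem grpIso_inv_hom_comp_hom {C : Type*} [Category C] [CartesianMonoidalCategory C] {G H : Grp C} (e : G ≅ H) :
    e.inv.hom.hom ≫ e.hom.hom.hom = 𝟙 H.X := by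
  change (e.inv ≫ e.hom).hom.hom = _
  rw [Iso.inv_hom_id]
  rfl

include hfib hxR hηr hsr in
set_option maxHeartbeats 400000 in
/-- **THE KERNEL CLAUSE TRANSFERS ALONG A FLAT CLOSED `𝒦 ↪ 𝒜_{x_R}`.**  Same setting, `incl` moreover a closed immersion and `Ker U` flat over the stage: if `𝒦_{η_r}`, read
in `(𝒜|_U)_y` through the three-piece isomorphism, carries the kernel clause of `u` on all `T`-points, then `𝒦_{s_r}`, read in `(𝒜|_{U_s})_{ys}`, carries the kernel clause
of `ū` on all `T`-points (§1 coherence + ★ (v-gen) `kernelClause_baseChange_of_generic` over `V_r` for `U_{V_r}` and `incl ≫ τ`, `τ : 𝒜_{x_R} ≅ ((𝒜_z)_{V′})_{V_r}` the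
transitivity isomorphism). [cite: BoschLutkebohmertRaynaud1990, §7.1 Prop. 6 (p. 180)] [cite: SerreTate1968, §1 Lemma 2] [cite: GortzWedhorn2020, Definition 4.45 (2) (p. 117)] -/
theorem kernelClause_specialFibre_of_generic_model (𝒦 : Over Vr) (incl : 𝒦 ⟶ (𝒜.baseChange xR).X) [Flat 𝒦.hom]
    [IsClosedImmersion incl.left] [Flat (ker U).hom]
    (hclause : ∀ ⦃W : Over (Spec (.of Ω))⦄ (t : W ⟶ ((𝒜.baseChange xR).baseChange ηr).X),
      (∃ s : W ⟶ (Over.pullback ηr).obj 𝒦, s ≫ (Over.pullback ηr).map incl = t) ↔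
        (t ≫ (𝒜.fibreBaseChangeIso j y ≪≫ 𝒜.fibreCongrPtIso hpr ≪≫ (𝒜.fibreBaseChangeIso xR ηr).symm).inv.hom.hom.hom) ≫ u = 1)
    ⦃W : Over (Spec (.of κ))⦄ (t : W ⟶ ((𝒜.baseChange xR).baseChange sr).X) :
    (∃ s : W ⟶ (Over.pullback sr).obj 𝒦, s ≫ (Over.pullback sr).map incl = t) ↔
      (t ≫ (𝒜.fibreBaseChangeIso js ys ≪≫ 𝒜.fibreCongrPtIso hps ≪≫ (𝒜.fibreBaseChangeIso xR sr).symm).inv.hom.hom.hom) ≫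
        ((𝒜.fibreBaseChangeIso js ys ≪≫ 𝒜.fibreCongrPtIso hspt ≪≫ (𝒜.fibreBaseChangeIso z b).symm ≪≫ ((𝒜.baseChange z).fibreCongrPtIso es).symm ≪≫ ((𝒜.baseChange z).fibreBaseChangeIso g b').symm).hom ≫ fibreHom U b' ≫ (𝒞.fibreBaseChangeIso js ys'' ≪≫ 𝒞.fibreCongrPtIso hspt'' ≪≫ (𝒞.fibreBaseChangeIso z'' b).symm ≪≫ ((𝒞.baseChange z'').fibreCongrPtIso es).symm ≪≫ ((𝒞.baseChange z'').fibreBaseChangeIso g b').symm).inv).hom.hom.hom = 1 := by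
  subst hxR hηr hsr
  haveI := isMonHom_baseChangeHom U r
  -- the transitivity isomorphism `τ : 𝒜_{x_R} ≅ ((𝒜_z)_{V′})_{V_r}` over `V_r` and its inverse `σ`
  have c1 : ((𝒜.baseChange z).baseChangeCompGrpIso g r).hom.hom.hom ≫ ((𝒜.baseChange z).baseChangeCompGrpIso g r).inv.hom.hom = 𝟙 _ := grpIso_hom_hom_comp_inv ((𝒜.baseChange z).baseChangeCompGrpIso g r)
  have c2 : (𝒜.baseChangeCompGrpIso z (r ≫ g)).hom.hom.hom ≫ (𝒜.baseChangeCompGrpIso z (r ≫ g)).inv.hom.hom = 𝟙 _ := grpIso_hom_hom_comp_inv (𝒜.baseChangeCompGrpIso z (r ≫ g))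
  have c3 : (𝒜.baseChangeCompGrpIso z (r ≫ g)).inv.hom.hom ≫ (𝒜.baseChangeCompGrpIso z (r ≫ g)).hom.hom.hom = 𝟙 _ := grpIso_inv_hom_comp_hom (𝒜.baseChangeCompGrpIso z (r ≫ g))
  have c4 : ((𝒜.baseChange z).baseChangeCompGrpIso g r).inv.hom.hom ≫ ((𝒜.baseChange z).baseChangeCompGrpIso g r).hom.hom.hom = 𝟙 _ := grpIso_inv_hom_comp_hom ((𝒜.baseChange z).baseChangeCompGrpIso g r)
  have hτσ : ((𝒜.baseChangeCompGrpIso z (r ≫ g)).hom.hom.hom ≫ ((𝒜.baseChange z).baseChangeCompGrpIso g r).hom.hom.hom) ≫ (((𝒜.baseChange z).baseChangeCompGrpIso g r).inv.hom.hom ≫ (𝒜.baseChangeCompGrpIso z (r ≫ g)).inv.hom.hom) = 𝟙 _ := by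
    simp only [Category.assoc, reassoc_of% c1, c2]
  have hστ : (((𝒜.baseChange z).baseChangeCompGrpIso g r).inv.hom.hom ≫ (𝒜.baseChangeCompGrpIso z (r ≫ g)).inv.hom.hom) ≫ ((𝒜.baseChangeCompGrpIso z (r ≫ g)).hom.hom.hom ≫ ((𝒜.baseChange z).baseChangeCompGrpIso g r).hom.hom.hom) = 𝟙 _ := by
    simp only [Category.assoc, reassoc_of% c3, c4]
  haveI : IsIso ((𝒜.baseChangeCompGrpIso z (r ≫ g)).hom.hom.hom ≫ ((𝒜.baseChange z).baseChangeCompGrpIso g r).hom.hom.hom).left :=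
    ⟨⟨(((𝒜.baseChange z).baseChangeCompGrpIso g r).inv.hom.hom ≫ (𝒜.baseChangeCompGrpIso z (r ≫ g)).inv.hom.hom).left, by rw [← Over.comp_left, hτσ]; rfl, by rw [← Over.comp_left, hστ]; rfl⟩⟩
  haveI : IsClosedImmersion (incl ≫ ((𝒜.baseChangeCompGrpIso z (r ≫ g)).hom.hom.hom ≫ ((𝒜.baseChange z).baseChangeCompGrpIso g r).hom.hom.hom)).left := by
    rw [Over.comp_left]
    infer_instance
  haveI : IsIso (GroupSchemes.GroupSchemeKernel.baseChangeIso r U).inv.left :=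
    ⟨⟨(GroupSchemes.GroupSchemeKernel.baseChangeIso r U).hom.left,
      by rw [← Over.comp_left, Iso.inv_hom_id]; rfl, by rw [← Over.comp_left, Iso.hom_inv_id]; rfl⟩⟩
  haveI : Flat (ker (baseChangeHom U r)).hom := by
    rw [← Over.w (GroupSchemes.GroupSchemeKernel.baseChangeIso r U).inv]
    change Flat ((GroupSchemes.GroupSchemeKernel.baseChangeIso r U).inv.left ≫ pullback.snd (ker U).hom r)
    infer_instance
  -- the generic and special fibres of `τ ≫ U_r` (§1 coherence, `hfib`)
  have hbc : fibreHom (baseChangeHom U r) ηr = (((𝒜.baseChange z).baseChange g).fibreBaseChangeIso r ηr).hom ≫ fibreHom U (ηr ≫ r) ≫ (((𝒞.baseChange z'').baseChange g).fibreBaseChangeIso r ηr).inv := by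
    rw [← Category.assoc, Iso.eq_comp_inv]
    exact fibreHom_baseChangeHom_comp_fibreBaseChangeIso_hom r ηr U
  have hAV : fibreHom (((𝒜.baseChangeCompGrpIso z (r ≫ g)).hom.hom.hom ≫ ((𝒜.baseChange z).baseChangeCompGrpIso g r).hom.hom.hom) ≫ baseChangeHom U r) ηr =
      (𝒜.fibreBaseChangeIso j y ≪≫ 𝒜.fibreCongrPtIso hpr ≪≫ (𝒜.fibreBaseChangeIso ((r ≫ g) ≫ z) ηr).symm).inv ≫ homOfIsMonHom u ≫
        (𝒞.fibreBaseChangeIso j y'' ≪≫ 𝒞.fibreCongrPtIso hpt'' ≪≫ (𝒞.fibreBaseChangeIso z'' a).symm ≪≫ ((𝒞.baseChange z'').fibreCongrPtIso e).symm ≪≫ ((𝒞.baseChange z'').fibreBaseChangeIso g (ηr ≫ r)).symm).hom ≫ (((𝒞.baseChange z'').baseChange g).fibreBaseChangeIso r ηr).inv := by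
    rw [fibreHom_comp, hbc, hfib, ← fibreHom_comp_five_inv_eq_three_inv j z g r y a ηr hpt e hpr 𝒜]
    simp only [Category.assoc]
  have e1 : (Over.pullback ηr).map (((𝒜.baseChangeCompGrpIso z (r ≫ g)).hom.hom.hom ≫ ((𝒜.baseChange z).baseChangeCompGrpIso g r).hom.hom.hom) ≫ baseChangeHom U r) =
      (𝒜.fibreBaseChangeIso j y ≪≫ 𝒜.fibreCongrPtIso hpr ≪≫ (𝒜.fibreBaseChangeIso ((r ≫ g) ≫ z) ηr).symm).inv.hom.hom.hom ≫ u ≫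
        ((𝒞.fibreBaseChangeIso j y'' ≪≫ 𝒞.fibreCongrPtIso hpt'' ≪≫ (𝒞.fibreBaseChangeIso z'' a).symm ≪≫ ((𝒞.baseChange z'').fibreCongrPtIso e).symm ≪≫ ((𝒞.baseChange z'').fibreBaseChangeIso g (ηr ≫ r)).symm) ≪≫ (((𝒞.baseChange z'').baseChange g).fibreBaseChangeIso r ηr).symm).hom.hom.hom.hom := by
    change (fibreHom (((𝒜.baseChangeCompGrpIso z (r ≫ g)).hom.hom.hom ≫ ((𝒜.baseChange z).baseChangeCompGrpIso g r).hom.hom.hom) ≫ baseChangeHom U r) ηr).hom.hom.hom = _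
    rw [hAV]
    rfl
  have hbcs : fibreHom (baseChangeHom U r) sr = (((𝒜.baseChange z).baseChange g).fibreBaseChangeIso r sr).hom ≫ fibreHom U (sr ≫ r) ≫ (((𝒞.baseChange z'').baseChange g).fibreBaseChangeIso r sr).inv := by
    rw [← Category.assoc, Iso.eq_comp_inv]
    exact fibreHom_baseChangeHom_comp_fibreBaseChangeIso_hom r sr U
  have hAVs : fibreHom (((𝒜.baseChangeCompGrpIso z (r ≫ g)).hom.hom.hom ≫ ((𝒜.baseChange z).baseChangeCompGrpIso g r).hom.hom.hom) ≫ baseChangeHom U r) sr =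
      (𝒜.fibreBaseChangeIso js ys ≪≫ 𝒜.fibreCongrPtIso hps ≪≫ (𝒜.fibreBaseChangeIso ((r ≫ g) ≫ z) sr).symm).inv ≫
        ((𝒜.fibreBaseChangeIso js ys ≪≫ 𝒜.fibreCongrPtIso hspt ≪≫ (𝒜.fibreBaseChangeIso z b).symm ≪≫ ((𝒜.baseChange z).fibreCongrPtIso es).symm ≪≫ ((𝒜.baseChange z).fibreBaseChangeIso g (sr ≫ r)).symm).hom ≫ fibreHom U (sr ≫ r) ≫ (𝒞.fibreBaseChangeIso js ys'' ≪≫ 𝒞.fibreCongrPtIso hspt'' ≪≫ (𝒞.fibreBaseChangeIso z'' b).symm ≪≫ ((𝒞.baseChange z'').fibreCongrPtIso es).symm ≪≫ ((𝒞.baseChange z'').fibreBaseChangeIso g (sr ≫ r)).symm).inv) ≫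
        (𝒞.fibreBaseChangeIso js ys'' ≪≫ 𝒞.fibreCongrPtIso hspt'' ≪≫ (𝒞.fibreBaseChangeIso z'' b).symm ≪≫ ((𝒞.baseChange z'').fibreCongrPtIso es).symm ≪≫ ((𝒞.baseChange z'').fibreBaseChangeIso g (sr ≫ r)).symm).hom ≫ (((𝒞.baseChange z'').baseChange g).fibreBaseChangeIso r sr).inv := by
    rw [fibreHom_comp, hbcs, ← fibreHom_comp_five_inv_eq_three_inv js z g r ys b sr hspt es hps 𝒜]
    simp only [Category.assoc, Iso.inv_hom_id_assoc]
  have e2 : (Over.pullback sr).map (((𝒜.baseChangeCompGrpIso z (r ≫ g)).hom.hom.hom ≫ ((𝒜.baseChange z).baseChangeCompGrpIso g r).hom.hom.hom) ≫ baseChangeHom U r) =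
      (𝒜.fibreBaseChangeIso js ys ≪≫ 𝒜.fibreCongrPtIso hps ≪≫ (𝒜.fibreBaseChangeIso ((r ≫ g) ≫ z) sr).symm).inv.hom.hom.hom ≫
        ((𝒜.fibreBaseChangeIso js ys ≪≫ 𝒜.fibreCongrPtIso hspt ≪≫ (𝒜.fibreBaseChangeIso z b).symm ≪≫ ((𝒜.baseChange z).fibreCongrPtIso es).symm ≪≫ ((𝒜.baseChange z).fibreBaseChangeIso g (sr ≫ r)).symm).hom ≫ fibreHom U (sr ≫ r) ≫ (𝒞.fibreBaseChangeIso js ys'' ≪≫ 𝒞.fibreCongrPtIso hspt'' ≪≫ (𝒞.fibreBaseChangeIso z'' b).symm ≪≫ ((𝒞.baseChange z'').fibreCongrPtIso es).symm ≪≫ ((𝒞.baseChange z'').fibreBaseChangeIso g (sr ≫ r)).symm).inv).hom.hom.hom ≫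
        ((𝒞.fibreBaseChangeIso js ys'' ≪≫ 𝒞.fibreCongrPtIso hspt'' ≪≫ (𝒞.fibreBaseChangeIso z'' b).symm ≪≫ ((𝒞.baseChange z'').fibreCongrPtIso es).symm ≪≫ ((𝒞.baseChange z'').fibreBaseChangeIso g (sr ≫ r)).symm) ≪≫ (((𝒞.baseChange z'').baseChange g).fibreBaseChangeIso r sr).symm).hom.hom.hom.hom := by
    change (fibreHom (((𝒜.baseChangeCompGrpIso z (r ≫ g)).hom.hom.hom ≫ ((𝒜.baseChange z).baseChangeCompGrpIso g r).hom.hom.hom) ≫ baseChangeHom U r) sr).hom.hom.hom = _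
    rw [hAVs]
    rfl
  -- the clause for `U_{V_r}` and `incl ≫ τ` at `η_r`
  have hgen' : ∀ ⦃W : Over (Spec (.of Ω))⦄ (t' : W ⟶ ((((𝒜.baseChange z).baseChange g).baseChange r).baseChange ηr).X),
      (∃ s : W ⟶ (Over.pullback ηr).obj 𝒦, s ≫ (Over.pullback ηr).map (incl ≫ ((𝒜.baseChangeCompGrpIso z (r ≫ g)).hom.hom.hom ≫ ((𝒜.baseChange z).baseChangeCompGrpIso g r).hom.hom.hom)) = t') ↔
        t' ≫ (Over.pullback ηr).map (baseChangeHom U r) = (1 : W ⟶ ((((𝒞.baseChange z'').baseChange g).baseChange r).baseChange ηr).X) := by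
    intro W t'
    have L : (∃ s : W ⟶ (Over.pullback ηr).obj 𝒦, s ≫ (Over.pullback ηr).map (incl ≫ ((𝒜.baseChangeCompGrpIso z (r ≫ g)).hom.hom.hom ≫ ((𝒜.baseChange z).baseChangeCompGrpIso g r).hom.hom.hom)) = t') ↔
        (∃ s : W ⟶ (Over.pullback ηr).obj 𝒦, s ≫ (Over.pullback ηr).map incl =
          t' ≫ (Over.pullback ηr).map (((𝒜.baseChange z).baseChangeCompGrpIso g r).inv.hom.hom ≫ (𝒜.baseChangeCompGrpIso z (r ≫ g)).inv.hom.hom)) := by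
      refine exists_congr fun s => ⟨fun h => ?_, fun h => ?_⟩
      · rw [← h]
        simp only [← Functor.map_comp, Category.assoc, reassoc_of% c1, c2, Category.comp_id]
      · rw [Functor.map_comp, reassoc_of% h]
        simp only [← Functor.map_comp, Category.assoc, reassoc_of% c3, c4, CategoryTheory.Functor.map_id]
        exact Category.comp_id _
    have e0 : (Over.pullback ηr).map (baseChangeHom U r) =
        (Over.pullback ηr).map (((𝒜.baseChange z).baseChangeCompGrpIso g r).inv.hom.hom ≫ (𝒜.baseChangeCompGrpIso z (r ≫ g)).inv.hom.hom) ≫ (Over.pullback ηr).map (((𝒜.baseChangeCompGrpIso z (r ≫ g)).hom.hom.hom ≫ ((𝒜.baseChange z).baseChangeCompGrpIso g r).hom.hom.hom) ≫ baseChangeHom U r) := by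
      simp only [← Functor.map_comp, Category.assoc, reassoc_of% c3, reassoc_of% c4]
    refine L.trans ((hclause (t' ≫ (Over.pullback ηr).map (((𝒜.baseChange z).baseChangeCompGrpIso g r).inv.hom.hom ≫ (𝒜.baseChangeCompGrpIso z (r ≫ g)).inv.hom.hom))).trans ?_)
    rw [e0, e1, ← (comp_avIso_hom_eq_one_iff' ((𝒞.fibreBaseChangeIso j y'' ≪≫ 𝒞.fibreCongrPtIso hpt'' ≪≫ (𝒞.fibreBaseChangeIso z'' a).symm ≪≫ ((𝒞.baseChange z'').fibreCongrPtIso e).symm ≪≫ ((𝒞.baseChange z'').fibreBaseChangeIso g (ηr ≫ r)).symm) ≪≫ (((𝒞.baseChange z'').baseChange g).fibreBaseChangeIso r ηr).symm)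
      (((t' ≫ (Over.pullback ηr).map (((𝒜.baseChange z).baseChangeCompGrpIso g r).inv.hom.hom ≫ (𝒜.baseChangeCompGrpIso z (r ≫ g)).inv.hom.hom)) ≫
        (𝒜.fibreBaseChangeIso j y ≪≫ 𝒜.fibreCongrPtIso hpr ≪≫ (𝒜.fibreBaseChangeIso ((r ≫ g) ≫ z) ηr).symm).inv.hom.hom.hom) ≫ u))]
    simp only [Category.assoc]
  -- ★ (v-gen) at `s_r`, for `t ≫ τ_{s_r}`
  have main := kernelClause_baseChange_of_generic ηr (baseChangeHom U r) (incl ≫ ((𝒜.baseChangeCompGrpIso z (r ≫ g)).hom.hom.hom ≫ ((𝒜.baseChange z).baseChangeCompGrpIso g r).hom.hom.hom)) hgen' sr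
    (t ≫ (Over.pullback sr).map ((𝒜.baseChangeCompGrpIso z (r ≫ g)).hom.hom.hom ≫ ((𝒜.baseChange z).baseChangeCompGrpIso g r).hom.hom.hom))
  have L2 : (∃ s : W ⟶ (Over.pullback sr).obj 𝒦, s ≫ (Over.pullback sr).map (incl ≫ ((𝒜.baseChangeCompGrpIso z (r ≫ g)).hom.hom.hom ≫ ((𝒜.baseChange z).baseChangeCompGrpIso g r).hom.hom.hom)) =
        t ≫ (Over.pullback sr).map ((𝒜.baseChangeCompGrpIso z (r ≫ g)).hom.hom.hom ≫ ((𝒜.baseChange z).baseChangeCompGrpIso g r).hom.hom.hom)) ↔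
      (∃ s : W ⟶ (Over.pullback sr).obj 𝒦, s ≫ (Over.pullback sr).map incl = t) := by
    refine exists_congr fun s => ⟨fun h => ?_, fun h => ?_⟩
    · have h2 := congrArg (fun φ => φ ≫ (Over.pullback sr).map (((𝒜.baseChange z).baseChangeCompGrpIso g r).inv.hom.hom ≫ (𝒜.baseChangeCompGrpIso z (r ≫ g)).inv.hom.hom)) h
      simp only [← Functor.map_comp, Category.assoc, reassoc_of% c1, c2, Category.comp_id, CategoryTheory.Functor.map_id] at h2
      exact h2
    · rw [← h]
      simp only [Functor.map_comp, Category.assoc]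
  have e3 : (t ≫ (Over.pullback sr).map ((𝒜.baseChangeCompGrpIso z (r ≫ g)).hom.hom.hom ≫ ((𝒜.baseChange z).baseChangeCompGrpIso g r).hom.hom.hom)) ≫ (Over.pullback sr).map (baseChangeHom U r) =
      ((t ≫ (𝒜.fibreBaseChangeIso js ys ≪≫ 𝒜.fibreCongrPtIso hps ≪≫ (𝒜.fibreBaseChangeIso ((r ≫ g) ≫ z) sr).symm).inv.hom.hom.hom) ≫
        ((𝒜.fibreBaseChangeIso js ys ≪≫ 𝒜.fibreCongrPtIso hspt ≪≫ (𝒜.fibreBaseChangeIso z b).symm ≪≫ ((𝒜.baseChange z).fibreCongrPtIso es).symm ≪≫ ((𝒜.baseChange z).fibreBaseChangeIso g (sr ≫ r)).symm).hom ≫ fibreHom U (sr ≫ r) ≫ (𝒞.fibreBaseChangeIso js ys'' ≪≫ 𝒞.fibreCongrPtIso hspt'' ≪≫ (𝒞.fibreBaseChangeIso z'' b).symm ≪≫ ((𝒞.baseChange z'').fibreCongrPtIso es).symm ≪≫ ((𝒞.baseChange z'').fibreBaseChangeIso g (sr ≫ r)).symm).inv).hom.hom.hom) ≫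
        ((𝒞.fibreBaseChangeIso js ys'' ≪≫ 𝒞.fibreCongrPtIso hspt'' ≪≫ (𝒞.fibreBaseChangeIso z'' b).symm ≪≫ ((𝒞.baseChange z'').fibreCongrPtIso es).symm ≪≫ ((𝒞.baseChange z'').fibreBaseChangeIso g (sr ≫ r)).symm) ≪≫ (((𝒞.baseChange z'').baseChange g).fibreBaseChangeIso r sr).symm).hom.hom.hom.hom := by
    have h4 : (t ≫ (Over.pullback sr).map ((𝒜.baseChangeCompGrpIso z (r ≫ g)).hom.hom.hom ≫ ((𝒜.baseChange z).baseChangeCompGrpIso g r).hom.hom.hom)) ≫ (Over.pullback sr).map (baseChangeHom U r) =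
        t ≫ (Over.pullback sr).map (((𝒜.baseChangeCompGrpIso z (r ≫ g)).hom.hom.hom ≫ ((𝒜.baseChange z).baseChangeCompGrpIso g r).hom.hom.hom) ≫ baseChangeHom U r) := by
      simp only [Functor.map_comp, Category.assoc]
    rw [h4, e2]
    simp only [Category.assoc]
  rw [← L2, main, e3, comp_avIso_hom_eq_one_iff']

include hfib hxR hηr hsr in
set_option maxHeartbeats 400000 in
/-- **THE SIX TRANSFERS AT ONCE** (for the head of ★ (ν8R): one application instead of six).  For `ū := E_𝒜 ≫ U_{b′} ≫ E_𝒞⁻¹` read on group schemes: `ū` is a homomorphism;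
(i) `U_{b′}` an isogeny ⇒ `ū` flat surjective; (ii)(iii)(iv) ★ (ν8) §1; (v-b) KILL and (v-a) CLAUSE along a flat (closed) `𝒦 ↪ 𝒜_{x_R}` (§2).
[cite: SerreTate1968, §1] [cite: BoschLutkebohmertRaynaud1990, §7.1 Prop. 6 and §7.3 Prop. 6 (p. 180)] [cite: MumfordFogartyKirwan1994, Ch. 6 §1 Corollary 6.2 (p. 116); Ch. 7 §2 Definition 7.2 (p. 129)] -/
theorem specialFibre_transfers_of_generic_model [QuasiCompact a'] [IsSchemeTheoreticallyDominant a'] [IsLocallyNoetherian V'] [PreconnectedSpace V'] [IsReduced V'] :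
    ∃ (_ : IsMonHom ((𝒜.fibreBaseChangeIso js ys ≪≫ 𝒜.fibreCongrPtIso hspt ≪≫ (𝒜.fibreBaseChangeIso z b).symm ≪≫ ((𝒜.baseChange z).fibreCongrPtIso es).symm ≪≫ ((𝒜.baseChange z).fibreBaseChangeIso g b').symm).hom ≫ fibreHom U b' ≫ (𝒞.fibreBaseChangeIso js ys'' ≪≫ 𝒞.fibreCongrPtIso hspt'' ≪≫ (𝒞.fibreBaseChangeIso z'' b).symm ≪≫ ((𝒞.baseChange z'').fibreCongrPtIso es).symm ≪≫ ((𝒞.baseChange z'').fibreBaseChangeIso g b').symm).inv).hom.hom.hom),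
      (AbelianVariety.IsIsogeny (fibreHom U b') → Flat (Over.Hom.left ((𝒜.fibreBaseChangeIso js ys ≪≫ 𝒜.fibreCongrPtIso hspt ≪≫ (𝒜.fibreBaseChangeIso z b).symm ≪≫ ((𝒜.baseChange z).fibreCongrPtIso es).symm ≪≫ ((𝒜.baseChange z).fibreBaseChangeIso g b').symm).hom ≫ fibreHom U b' ≫ (𝒞.fibreBaseChangeIso js ys'' ≪≫ 𝒞.fibreCongrPtIso hspt'' ≪≫ (𝒞.fibreBaseChangeIso z'' b).symm ≪≫ ((𝒞.baseChange z'').fibreCongrPtIso es).symm ≪≫ ((𝒞.baseChange z'').fibreBaseChangeIso g b').symm).inv).hom.hom.hom) ∧ Function.Surjective (Over.Hom.left ((𝒜.fibreBaseChangeIso js ys ≪≫ 𝒜.fibreCongrPtIso hspt ≪≫ (𝒜.fibreBaseChangeIso z b).symm ≪≫ ((𝒜.baseChange z).fibreCongrPtIso es).symm ≪≫ ((𝒜.baseChange z).fibreBaseChangeIso g b').symm).hom ≫ fibreHom U b' ≫ (𝒞.fibreBaseChangeIso js ys'' ≪≫ 𝒞.fibreCongrPtIso hspt'' ≪≫ (𝒞.fibreBaseChangeIso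 z'' b).symm ≪≫ ((𝒞.baseChange z'').fibreCongrPtIso es).symm ≪≫ ((𝒞.baseChange z'').fibreBaseChangeIso g b').symm).inv).hom.hom.hom).base) ∧
      (∀ (f : 𝒜.X ⟶ 𝒜.X) (g' : 𝒞.X ⟶ 𝒞.X) [IsMonHom f] [IsMonHom g'],
        baseChangeHom (baseChangeHom f j) y ≫ u = u ≫ baseChangeHom (baseChangeHom g' j) y'' →
        baseChangeHom (baseChangeHom f js) ys ≫ ((𝒜.fibreBaseChangeIso js ys ≪≫ 𝒜.fibreCongrPtIso hspt ≪≫ (𝒜.fibreBaseChangeIso z b).symm ≪≫ ((𝒜.baseChange z).fibreCongrPtIso es).symm ≪≫ ((𝒜.baseChange z).fibreBaseChangeIso g b').symm).hom ≫ fibreHom U b' ≫ (𝒞.fibreBaseChangeIso js ys'' ≪≫ 𝒞.fibreCongrPtIso hspt'' ≪≫ (𝒞.fibreBaseChangeIso z'' b).symm ≪≫ ((𝒞.baseChange z'').fibreCongrPtIso es).symm ≪≫ ((𝒞.baseChange z'').fibreBaseChangeIso g b').symm).inv).hom.hom.hom = ((𝒜.fibreBaseChangeIso js ys ≪≫ 𝒜.fibreCongrPtIso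 hspt ≪≫ (𝒜.fibreBaseChangeIso z b).symm ≪≫ ((𝒜.baseChange z).fibreCongrPtIso es).symm ≪≫ ((𝒜.baseChange z).fibreBaseChangeIso g b').symm).hom ≫ fibreHom U b' ≫ (𝒞.fibreBaseChangeIso js ys'' ≪≫ 𝒞.fibreCongrPtIso hspt'' ≪≫ (𝒞.fibreBaseChangeIso z'' b).symm ≪≫ ((𝒞.baseChange z'').fibreCongrPtIso es).symm ≪≫ ((𝒞.baseChange z'').fibreBaseChangeIso g b').symm).inv).hom.hom.hom ≫ baseChangeHom (baseChangeHom g' js) ys'') ∧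
      (∀ (τ : 𝒜.Sections) (τ'' : 𝒞.Sections),
        AlgPoints.map u ((𝒜.baseChange j).restrictPt y (𝒜.sectionBaseChange j τ)) = (𝒞.baseChange j).restrictPt y'' (𝒞.sectionBaseChange j τ'') →
        AlgPoints.map ((𝒜.fibreBaseChangeIso js ys ≪≫ 𝒜.fibreCongrPtIso hspt ≪≫ (𝒜.fibreBaseChangeIso z b).symm ≪≫ ((𝒜.baseChange z).fibreCongrPtIso es).symm ≪≫ ((𝒜.baseChange z).fibreBaseChangeIso g b').symm).hom ≫ fibreHom U b' ≫ (𝒞.fibreBaseChangeIso js ys'' ≪≫ 𝒞.fibreCongrPtIso hspt'' ≪≫ (𝒞.fibreBaseChangeIso z'' b).symm ≪≫ ((𝒞.baseChange z'').fibreCongrPtIso es).symm ≪≫ ((𝒞.baseChange z'').fibreBaseChangeIso g b').symm).inv).hom.hom.hom ((𝒜.baseChange js).restrictPt ys (𝒜.sectionBaseChange js τ)) = (𝒞.baseChange js).restrictPt ys'' (𝒞.sectionBaseChange js τ'')) ∧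
      (∀ (D𝒜 : 𝒜.DualPair) (pol𝒜 : 𝒜.Polarization D𝒜) (D𝒞 : 𝒞.DualPair) (pol𝒞 : 𝒞.Polarization D𝒞) (n : ℕ),
        u ≫ ((pol𝒞.baseChange j).baseChange y'').lam ≫ DualPair.dualIsogenyOver u ((D𝒜.baseChange j).baseChange y) ((D𝒞.baseChange j).baseChange y'') =
          ((pol𝒜.baseChange j).baseChange y).lam ≫ ((D𝒜.baseChange j).baseChange y).hat.mulN n →
        ((𝒜.fibreBaseChangeIso js ys ≪≫ 𝒜.fibreCongrPtIso hspt ≪≫ (𝒜.fibreBaseChangeIso z b).symm ≪≫ ((𝒜.baseChange z).fibreCongrPtIso es).symm ≪≫ ((𝒜.baseChange z).fibreBaseChangeIso g b').symm).hom ≫ fibreHom U b' ≫ (𝒞.fibreBaseChangeIso js ys'' ≪≫ 𝒞.fibreCongrPtIso hspt'' ≪≫ (𝒞.fibreBaseChangeIso z'' b).symm ≪≫ ((𝒞.baseChange z'').fibreCongrPtIso es).symm ≪≫ ((𝒞.baseChange z'').fibreBaseChangeIso g b').symm).inv).hom.hom.hom ≫ ((pol𝒞.baseChange js).baseChange ys'').lam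 ≫
            @DualPair.dualIsogenyOver _ ((𝒜.baseChange js).baseChange ys) ((𝒞.baseChange js).baseChange ys'') ((𝒜.fibreBaseChangeIso js ys ≪≫ 𝒜.fibreCongrPtIso hspt ≪≫ (𝒜.fibreBaseChangeIso z b).symm ≪≫ ((𝒜.baseChange z).fibreCongrPtIso es).symm ≪≫ ((𝒜.baseChange z).fibreBaseChangeIso g b').symm).hom ≫ fibreHom U b' ≫ (𝒞.fibreBaseChangeIso js ys'' ≪≫ 𝒞.fibreCongrPtIso hspt'' ≪≫ (𝒞.fibreBaseChangeIso z'' b).symm ≪≫ ((𝒞.baseChange z'').fibreCongrPtIso es).symm ≪≫ ((𝒞.baseChange z'').fibreBaseChangeIso g b').symm).inv).hom.hom.hom ((𝒜.fibreBaseChangeIso js ys ≪≫ 𝒜.fibreCongrPtIso hspt ≪≫ (𝒜.fibreBaseChangeIso z b).symm ≪≫ ((𝒜.baseChange z).fibreCongrPtIso es).symm ≪≫ ((𝒜.baseChange z).fibreBaseChangeIso g b').symm).hom ≫ fibreHom U b' ≫ (𝒞.fibreBaseChangeIso js ys'' ≪≫ 𝒞.fibreCongrPtIso hspt'' ≪≫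 (𝒞.fibreBaseChangeIso z'' b).symm ≪≫ ((𝒞.baseChange z'').fibreCongrPtIso es).symm ≪≫ ((𝒞.baseChange z'').fibreBaseChangeIso g b').symm).inv).hom.hom.isMonHom_hom
              ((D𝒜.baseChange js).baseChange ys) ((D𝒞.baseChange js).baseChange ys'') =
          ((pol𝒜.baseChange js).baseChange ys).lam ≫ ((D𝒜.baseChange js).baseChange ys).hat.mulN n) ∧
      -- (v-b) KILL along a flat `𝒦 ↪ 𝒜_{x_R}`
      (∀ (𝒦 : Over Vr) (incl : 𝒦 ⟶ (𝒜.baseChange xR).X) [Flat 𝒦.hom],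
        ((Over.pullback ηr).map incl ≫ (𝒜.fibreBaseChangeIso j y ≪≫ 𝒜.fibreCongrPtIso hpr ≪≫ (𝒜.fibreBaseChangeIso xR ηr).symm).inv.hom.hom.hom) ≫ u = 1 →
        ((Over.pullback sr).map incl ≫ (𝒜.fibreBaseChangeIso js ys ≪≫ 𝒜.fibreCongrPtIso hps ≪≫ (𝒜.fibreBaseChangeIso xR sr).symm).inv.hom.hom.hom) ≫ ((𝒜.fibreBaseChangeIso js ys ≪≫ 𝒜.fibreCongrPtIso hspt ≪≫ (𝒜.fibreBaseChangeIso z b).symm ≪≫ ((𝒜.baseChange z).fibreCongrPtIso es).symm ≪≫ ((𝒜.baseChange z).fibreBaseChangeIso g b').symm).hom ≫ fibreHom U b' ≫ (𝒞.fibreBaseChangeIso js ys'' ≪≫ 𝒞.fibreCongrPtIso hspt'' ≪≫ (𝒞.fibreBaseChangeIso z'' b).symm ≪≫ ((𝒞.baseChange z'').fibreCongrPtIso es).symm ≪≫ ((𝒞.baseChange z'').fibreBaseChangeIso g b').symm).inv).hom.hom.hom = 1) ∧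
      -- (v-a) the kernel CLAUSE along a flat closed `𝒦 ↪ 𝒜_{x_R}`, when `Ker U` is flat over the stage
      (Flat (ker U).hom → ∀ (𝒦 : Over Vr) (incl : 𝒦 ⟶ (𝒜.baseChange xR).X) [Flat 𝒦.hom] [IsClosedImmersion incl.left],
        (∀ ⦃W : Over (Spec (.of Ω))⦄ (t : W ⟶ ((𝒜.baseChange xR).baseChange ηr).X),
          (∃ s : W ⟶ (Over.pullback ηr).obj 𝒦, s ≫ (Over.pullback ηr).map incl = t) ↔ (t ≫ (𝒜.fibreBaseChangeIso j y ≪≫ 𝒜.fibreCongrPtIso hpr ≪≫ (𝒜.fibreBaseChangeIso xR ηr).symm).inv.hom.hom.hom) ≫ u = 1) →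
        ∀ ⦃W : Over (Spec (.of κ))⦄ (t : W ⟶ ((𝒜.baseChange xR).baseChange sr).X),
          (∃ s : W ⟶ (Over.pullback sr).obj 𝒦, s ≫ (Over.pullback sr).map incl = t) ↔
            (t ≫ (𝒜.fibreBaseChangeIso js ys ≪≫ 𝒜.fibreCongrPtIso hps ≪≫ (𝒜.fibreBaseChangeIso xR sr).symm).inv.hom.hom.hom) ≫ ((𝒜.fibreBaseChangeIso js ys ≪≫ 𝒜.fibreCongrPtIso hspt ≪≫ (𝒜.fibreBaseChangeIso z b).symm ≪≫ ((𝒜.baseChange z).fibreCongrPtIso es).symm ≪≫ ((𝒜.baseChange z).fibreBaseChangeIso g b').symm).hom ≫ fibreHom U b' ≫ (𝒞.fibreBaseChangeIso js ys'' ≪≫ 𝒞.fibreCongrPtIso hspt'' ≪≫ (𝒞.fibreBaseChangeIso z'' b).symm ≪≫ ((𝒞.baseChange z'').fibreCongrPtIso es).symm ≪≫ ((𝒞.baseChange z'').fibreBaseChangeIso g b').symm).inv).hom.hom.hom = 1) := by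
  refine ⟨((𝒜.fibreBaseChangeIso js ys ≪≫ 𝒜.fibreCongrPtIso hspt ≪≫ (𝒜.fibreBaseChangeIso z b).symm ≪≫ ((𝒜.baseChange z).fibreCongrPtIso es).symm ≪≫ ((𝒜.baseChange z).fibreBaseChangeIso g b').symm).hom ≫ fibreHom U b' ≫ (𝒞.fibreBaseChangeIso js ys'' ≪≫ 𝒞.fibreCongrPtIso hspt'' ≪≫ (𝒞.fibreBaseChangeIso z'' b).symm ≪≫ ((𝒞.baseChange z'').fibreCongrPtIso es).symm ≪≫ ((𝒞.baseChange z'').fibreBaseChangeIso g b').symm).inv).hom.hom.isMonHom_hom, fun hUb => ?_,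
    fun f g' _ _ hfg => baseChangeHom_comp_specialFibre_eq_of_generic j z z'' g y y'' a a' hpt hpt'' e js ys ys'' b b' hspt hspt'' es 𝒜 𝒞 U u hfib f g' hfg,
    fun τ τ'' hτ => map_specialFibre_restrictPt_eq_of_generic j z z'' g y y'' a a' hpt hpt'' e js ys ys'' b b' hspt hspt'' es 𝒜 𝒞 U u hfib τ τ'' hτ,
    fun D𝒜 pol𝒜 D𝒞 pol𝒞 n hlam => specialFibre_comp_lam_comp_dualIsogenyOver_eq_of_generic j z z'' g y y'' a a' hpt hpt'' e js ys ys'' b b' hspt hspt'' es 𝒜 𝒞 U u hfib D𝒜 pol𝒜 D𝒞 pol𝒞 n hlam,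
    fun 𝒦 incl _ hkill => pullback_map_comp_specialFibre_eq_one_of_generic j z z'' g y y'' a a' hpt hpt'' e js ys ys'' b b' hspt hspt'' es 𝒜 𝒞 U u hfib r xR hxR ηr sr hηr hsr hpr hps 𝒦 incl hkill,
    fun hflat 𝒦 incl _ _ hclause W t => ?_⟩
  · have hub : AbelianVariety.IsIsogeny ((𝒜.fibreBaseChangeIso js ys ≪≫ 𝒜.fibreCongrPtIso hspt ≪≫ (𝒜.fibreBaseChangeIso z b).symm ≪≫ ((𝒜.baseChange z).fibreCongrPtIso es).symm ≪≫ ((𝒜.baseChange z).fibreBaseChangeIso g b').symm).hom ≫ fibreHom U b' ≫ (𝒞.fibreBaseChangeIso js ys'' ≪≫ 𝒞.fibreCongrPtIso hspt'' ≪≫ (𝒞.fibreBaseChangeIso z'' b).symm ≪≫ ((𝒞.baseChange z'').fibreCongrPtIso es).symm ≪≫ ((𝒞.baseChange z'').fibreBaseChangeIso g b').symm).inv) := isIsogeny_hom_comp_iso _ (fibreHom U b') (𝒞.fibreBaseChangeIso js ys'' ≪≫ 𝒞.fibreCongrPtIso hspt'' ≪≫ (𝒞.fibreBaseChangeIso z''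 b).symm ≪≫ ((𝒞.baseChange z'').fibreCongrPtIso es).symm ≪≫ ((𝒞.baseChange z'').fibreBaseChangeIso g b').symm).symm hUb
    exact ⟨hub.flat, hub.1.surj⟩
  · haveI := hflat
    exact kernelClause_specialFibre_of_generic_model j z z'' g y y'' a a' hpt hpt'' e js ys ys'' b b' hspt hspt'' es 𝒜 𝒞 U u hfib r xR hxR ηr sr hηr hsr hpr hps 𝒦 incl hclause t

end Model

end AbelianSchemeOver

end Literature.AlgebraicGeometry.AbelianSchemes

end
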